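import Summits.QuantumFields.YangMills.Theorems.UnitScaleTiltProp7CovariantBlockPoincare
import Literature.MathematicalPhysics.QuantumFieldTheory.Balaban1983to89.B7Prop3GeneralLinear
import Literature.MathematicalPhysics.QuantumFieldTheory.Balaban1983to89.B7Prop4Flat
import Literature.MathematicalPhysics.QuantumFieldTheory.Balaban1983to89.B15TreeGauge196Walks
import HarnessLib

/-!
# (n3)-COMB (II) «COMB = STRAIGHT ∘ BLOCK-AXIAL», file F-6a-1: LETTERS FOR THE COVARIANT IN-CELL ROW — walks in the block, the rotated sum (58) versus the abelian functional of the
# comb-transported field, the comb-gauge difference estimate on `ℤᵈ`, the cube Poincaré inequality with the mean (PREREAD §1 (a) dressed; MASTER §1 row 6; the row itself is F-6a-2)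

Crux `stmt-QuantumFields-19200` `MinimiserStabilityRegPr`, route-R E′ (A′)-on-Σ, P-A2 (β); the displayed route-internal row `hMcomb` (SIGNATURE-0; RULINGS №19 O4 ∕ №22; OPEN, XL) and its
supplier design (II) (★★OWNER «(II) GO» of record 2026-08-29T06:31:31Z; pen F-6a named by ★routeR-w1 g9 07:15:27Z).  Seat ym-routeR-w6 g8; `--kind proof --supports stmt-QuantumFields-19200
--as helper`; THEOREMS ONLY; «(O2) groundwork — not consumed by any displayed row before the freeze lifts»; count-neutral.  YM₃ on T³ is a ladder rung (R3), not Clay; nothing here is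
progress on the YM mass gap.

OBJECTS (lit `B7Prop1Explicit`∕`B7Prop3GeneralRotated`∕`B7Prop3GeneralLinear` letters on `ℤᵈ`, `𝔸 = M_N(ℂ)` with the operator norm): a `U1`-valued background `V` whose unit plaquettes are within
`a` of `1` ((44)); a level field `X`; the block `B(q) = q + [0, n]ᵈ` of side `L = n + 1`; the COMB-TRANSPORTED field `Xᵀ(y, μ) := R(V(Γ_{q,y}))X(y, μ)` (`Γ_{q,y} = treeWord (y − q)`, p. 24) and its
block means `X̄_μ(q) := L⁻ᵈ Σ_{s} Xᵀ(q + s, μ)`; the comb-tree functional `F̂ := FhatCov L V X q = Σ_r L⁻ᵈ (R_{0,q}X)(Γ_{q,q+r})` ((112)).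
THIS FILE (letters; the in-cell row ★★★`norm_FhatCov_sub_drift_sq_le` is F-6a-2 `…CornerCombInCellPoincare`, which imports it): §1 ★`norm_conjR_tsum_sub_asum_le` — along any positively oriented
walk `Γ` in `S ⊆ {|y − q|₁ ≤ R}`, `R(g)·(R_{0,x}X)(Γ)` differs from the abelian functional `A[Xᵀ](Γ)` by `≤ 2(δ + |Γ|·R·a)·Σ_{b∈Γ}‖X_b‖` (`‖g − V(Γ_{q,x})‖ ≤ δ`); the transport defect across ONE
bond is print's axial-gauge bond bound `|V₀,b − 1| ≤ |b₋ − q|₁·a` (lit ✓`axial_bond_bound`) — NO prefix-closedness of the tree and NO bond multiplicities are used; `norm_asum_le_length_mul`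
(local sup bound along a walk); §2 the block `q + [0,n]ᵈ`: `exists_boxVec_of_mem_box`, `l1_sub_le_of_mem_box`, `treeWord_boxVec_pos`, `length_treeWord_boxVec_le`, ★`pathIn_treeWord_boxVec` (lit
✓`pathIn_tw`), `norm_le_sqrt_blockSum` (a single bond is at most the block mass — ★routeR-w1 F-5b's device); §3 ★`norm_conjR_tree_sub_le` — the `ℤᵈ` twin of
✓`Prop7CovariantCoercivity.norm_conjR_comb_sub_le` (adapted from it): flat differences of `Xᵀ` are covariant differences up to `2|x − q|₁a‖X‖`; `sum_normSq_sub_mean_le` — the cube Poincaré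
inequality with the mean from ✓`block227_matrix`.  Constants: none beyond `N∕8·(n+1)²`; nothing depends on a level, `k`, the torus, `K`, the member (VERDICT (g1)(g2)).
NOT HERE: the drift∕assembly (F-6a-2), the scale chain (✓II-3 `Prop7LatticeScaleTelescoping`), sums over corners, Weitzenböck (F-6c∕F-6d).  HONEST: lattice analysis at one block; nothing of `hMcomb` ∕ `hMcomb₂` ∕ (β) ∕ `hD` ∕
hPA2 ∕ hcoS ∕ E′ ∕ EX ∕ the crux is proved or claimed; rung R3 (YM₃ on T³), NOT d = 4, NOT infinite volume, NOT Clay; YM gap NOT proved.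
-/

set_option autoImplicit false

open scoped BigOperators Matrix.Norms.L2Operator

namespace Summit.QuantumFields.YangMills.Theorems.Prop7CornerCombInCellLetters

open Literature.MathematicalPhysics.QuantumFieldTheory.Balaban1983to89
open Finset
open B7Prop1Explicit renaming Site → LSite
open B7Prop1Explicit (Letter e hol treeWord axialFn disp plaqWord l1 U1 gaugeAct axial_bond_bound hol_mem mem_U1 boxVec asum asum_cons asum_nil stepA seg_natCast
  stepHol_true length_treeWord)
open B7Eq78Linearization (conjR conjR_apply conjR_sub conjR_add)
open B8Ineq132 (norm_conjR conjR_conjR one_conjR)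
open B7Prop3GeneralRotated (tsum tstep tsum_cons)
open B7Prop3GeneralLinear (FhatCov)
open B7Prop4Flat (asum_sub)
open B8Lemma1NonAbelian (tw tw_cons tw_nil treeWord_eq_tw)
open B15TreeGauge196 (PathIn pathIn_cons pathIn_tw restrict_apply_of_mem)
open Beta.CoordCubePoincare (stepUp)
open Summit.QuantumFields.YangMills.Theorems.Prop7CovariantCoercivity (block227_matrix intVec_stepUp l1_intVec_le norm_conjR_sub_conjR_le)

variable {d N : ℕ} [NeZero N]

/-! ## §1 Along a positively oriented walk: the rotated sum versus the abelian functional of the comb-transported field -/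

/-- **THE TREE-TRANSPORT DEFECT ACROSS ONE BOND** — print's axial-gauge bond bound (pp. 24–25 «`|V₀,b − 1| < |b₋ − y|α₀`»): with `T(y) := V(Γ_{q,y})`,
`‖T(x)·V(x,μ) − T(x + e_μ)‖ ≤ |x − q|₁·a`. [cite: Balaban1985Averaging, pp.24–25] -/
theorem norm_transport_mul_sub_le (V : LSite d → Fin d → (Matrix (Fin N) (Fin N) ℂ)ˣ) (hV : ∀ x κ, V x κ ∈ U1 (Matrix (Fin N) (Fin N) ℂ)) {a : ℝ} (ha : 0 ≤ a)
    (hplaq : ∀ (x : LSite d) (κ μ : Fin d), κ ≠ μ → ‖((hol V x (plaqWord κ μ) : (Matrix (Fin N) (Fin N) ℂ)ˣ) : Matrix (Fin N) (Fin N) ℂ) - 1‖ ≤ a) (q x : LSite d) (μ : Fin d) :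
    ‖((hol V q (treeWord (x - q)) : (Matrix (Fin N) (Fin N) ℂ)ˣ) : Matrix (Fin N) (Fin N) ℂ) * ((V x μ : (Matrix (Fin N) (Fin N) ℂ)ˣ) : Matrix (Fin N) (Fin N) ℂ) - ((hol V q (treeWord (x + e μ - q)) : (Matrix (Fin N) (Fin N) ℂ)ˣ) : Matrix (Fin N) (Fin N) ℂ)‖ ≤ l1 (x - q) * a := by
  have hb := axial_bond_bound V hV q hplaq ha x μ
  set T₀ : (Matrix (Fin N) (Fin N) ℂ)ˣ := hol V q (treeWord (x - q)) with hT₀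
  set T₁ : (Matrix (Fin N) (Fin N) ℂ)ˣ := hol V q (treeWord (x + e μ - q)) with hT₁
  have hga : gaugeAct (axialFn V q) V x μ = T₀ * V x μ * T₁⁻¹ := rfl
  rw [hga] at hb
  have hT₁m : T₁ ∈ U1 (Matrix (Fin N) (Fin N) ℂ) := hol_mem hV _ _
  have hid : (T₀ : Matrix (Fin N) (Fin N) ℂ) * ((V x μ : (Matrix (Fin N) (Fin N) ℂ)ˣ) : Matrix (Fin N) (Fin N) ℂ) - (T₁ : Matrix (Fin N) (Fin N) ℂ) = (((T₀ * V x μ * T₁⁻¹ : (Matrix (Fin N) (Fin N) ℂ)ˣ) : Matrix (Fin N) (Fin N) ℂ) - 1) * (T₁ : Matrix (Fin N) (Fin N) ℂ) := by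
    rw [sub_mul, one_mul, Units.val_mul, Units.val_mul, mul_assoc ((T₀ : Matrix (Fin N) (Fin N) ℂ) * _), Units.inv_mul, mul_one]
  rw [hid]
  calc _ ≤ ‖((T₀ * V x μ * T₁⁻¹ : (Matrix (Fin N) (Fin N) ℂ)ˣ) : Matrix (Fin N) (Fin N) ℂ) - 1‖ * ‖(T₁ : Matrix (Fin N) (Fin N) ℂ)‖ := norm_mul_le _ _
    _ ≤ l1 (x - q) * a * 1 := mul_le_mul hb hT₁m.1 (norm_nonneg _) (by positivity)
    _ = l1 (x - q) * a := mul_one _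

/-- The abelian functional of a non-negative real bond function along a positively oriented walk is non-negative. [folklore] -/
theorem asum_nonneg (G : LSite d → Fin d → ℝ) (hG : ∀ y μ, 0 ≤ G y μ) :
    ∀ (x : LSite d) (w : List (Letter d)), (∀ l ∈ w, l.2 = true) → 0 ≤ asum G x w
  | x, [], _ => by simp
  | x, l :: w, hw => by
    obtain ⟨μ, b⟩ := l
    have hb : b = true := hw (μ, b) (by simp)
    subst hb
    rw [asum_cons]
    exact add_nonneg (by simp only [stepA, ↓reduceIte]; exact hG _ _) (asum_nonneg G hG _ w fun l hl => hw l (by simp [hl]))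

/-- **LOCAL SUP BOUND ALONG A WALK**: for a positively oriented walk in `S` and a bond function bounded by `M` on `S`, `‖A(Γ)‖ ≤ |Γ|·M` (the abelian companion of lit ✓`norm_tsum_le`,
localised). [cite: Balaban1985Averaging, (125)-(126) p.36] -/
theorem norm_asum_le_length_mul {𝔸 : Type*} [NormedRing 𝔸] (G : LSite d → Fin d → 𝔸) {S : Set (LSite d)} {M : ℝ} (hM : ∀ y ∈ S, ∀ μ, ‖G y μ‖ ≤ M) :
    ∀ (x : LSite d) (w : List (Letter d)), (∀ l ∈ w, l.2 = true) → PathIn S x w → ‖asum G x w‖ ≤ w.length * M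
  | x, [], _, _ => by simp
  | x, l :: w, hw, hP => by
    obtain ⟨μ, b⟩ := l
    have hb : b = true := hw (μ, b) (by simp)
    subst hb
    obtain ⟨hx, hP'⟩ := pathIn_cons.mp hP
    rw [asum_cons, List.length_cons, Nat.cast_succ, add_mul, one_mul, add_comm ((w.length : ℝ) * M)]
    refine (norm_add_le _ _).trans (add_le_add ?_ (norm_asum_le_length_mul G hM _ w (fun l hl => hw l (by simp [hl])) (by simpa using hP')))
    simp only [stepA, ↓reduceIte]
    exact hM x hx μ

/-- ★ **THE ROTATED SUM VERSUS THE ABELIAN FUNCTIONAL OF THE COMB-TRANSPORTED FIELD**: along a positively oriented walk `Γ` from `x` inside `S ⊆ {|y − q|₁ ≤ R}`, for any incoming rotation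
`g` with `‖g − V(Γ_{q,x})‖ ≤ δ`: `‖R(g)(R_{0,x}X)(Γ) − A[Xᵀ](Γ)‖ ≤ 2(δ + |Γ|·R·a)·Σ_{b∈Γ}‖X_b‖`, `Xᵀ(y,μ) = R(V(Γ_{q,y}))X(y,μ)` — each bond pays the accumulated tree-transport defect
(`norm_transport_mul_sub_le`), NO prefix-closedness of the tree is used. [cite: Balaban1985Averaging, pp.24–25, (58) p.27, (112) p.34] -/
theorem norm_conjR_tsum_sub_asum_le (V : LSite d → Fin d → (Matrix (Fin N) (Fin N) ℂ)ˣ) (hV : ∀ x κ, V x κ ∈ U1 (Matrix (Fin N) (Fin N) ℂ)) {a : ℝ} (ha : 0 ≤ a)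
    (hplaq : ∀ (x : LSite d) (κ μ : Fin d), κ ≠ μ → ‖((hol V x (plaqWord κ μ) : (Matrix (Fin N) (Fin N) ℂ)ˣ) : Matrix (Fin N) (Fin N) ℂ) - 1‖ ≤ a) (X : LSite d → Fin d → Matrix (Fin N) (Fin N) ℂ) (q : LSite d)
    {S : Set (LSite d)} {R : ℝ} (hR : 0 ≤ R) (hS : ∀ y ∈ S, (l1 (y - q) : ℝ) ≤ R) :
    ∀ (x : LSite d) (w : List (Letter d)), (∀ l ∈ w, l.2 = true) → PathIn S x w → ∀ (g : (Matrix (Fin N) (Fin N) ℂ)ˣ), g ∈ U1 (Matrix (Fin N) (Fin N) ℂ) → ∀ δ : ℝ,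
      ‖(g : Matrix (Fin N) (Fin N) ℂ) - ((hol V q (treeWord (x - q)) : (Matrix (Fin N) (Fin N) ℂ)ˣ) : Matrix (Fin N) (Fin N) ℂ)‖ ≤ δ →
      ‖conjR g (tsum V X x w) - asum (fun y μ => conjR (hol V q (treeWord (y - q))) (X y μ)) x w‖
        ≤ 2 * (δ + w.length * (R * a)) * asum (fun y μ => ‖X y μ‖) x w
  | x, [], _, _, g, _, δ, _ => by simp [conjR_apply]
  | x, l :: w, hw, hP, g, hg, δ, hδ => by
    obtain ⟨μ, b⟩ := l
    have hb : b = true := hw (μ, b) (by simp)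
    subst hb
    obtain ⟨hx, hP'⟩ := pathIn_cons.mp hP
    have hw' : ∀ l ∈ w, l.2 = true := fun l hl => hw l (by simp [hl])
    have hP'' : PathIn S (x + e μ) w := by simpa using hP'
    -- the incoming rotation of the tail and its defect
    have hg' : g * V x μ ∈ U1 (Matrix (Fin N) (Fin N) ℂ) := Subgroup.mul_mem _ hg (hV x μ)
    have hδ0 : 0 ≤ δ := (norm_nonneg _).trans hδ
    have hδ' : ‖((g * V x μ : (Matrix (Fin N) (Fin N) ℂ)ˣ) : Matrix (Fin N) (Fin N) ℂ) - ((hol V q (treeWord (x + e μ - q)) : (Matrix (Fin N) (Fin N) ℂ)ˣ) : Matrix (Fin N) (Fin N) ℂ)‖ ≤ δ + R * a := by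
      have h1 : ((g * V x μ : (Matrix (Fin N) (Fin N) ℂ)ˣ) : Matrix (Fin N) (Fin N) ℂ) - ((hol V q (treeWord (x + e μ - q)) : (Matrix (Fin N) (Fin N) ℂ)ˣ) : Matrix (Fin N) (Fin N) ℂ)
          = ((g : Matrix (Fin N) (Fin N) ℂ) - ((hol V q (treeWord (x - q)) : (Matrix (Fin N) (Fin N) ℂ)ˣ) : Matrix (Fin N) (Fin N) ℂ)) * ((V x μ : (Matrix (Fin N) (Fin N) ℂ)ˣ) : Matrix (Fin N) (Fin N) ℂ)
            + (((hol V q (treeWord (x - q)) : (Matrix (Fin N) (Fin N) ℂ)ˣ) : Matrix (Fin N) (Fin N) ℂ) * ((V x μ : (Matrix (Fin N) (Fin N) ℂ)ˣ) : Matrix (Fin N) (Fin N) ℂ) - ((hol V q (treeWord (x + e μ - q)) : (Matrix (Fin N) (Fin N) ℂ)ˣ) : Matrix (Fin N) (Fin N) ℂ)) := by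
        rw [Units.val_mul]; noncomm_ring
      rw [h1]
      refine (norm_add_le _ _).trans (add_le_add ?_ ((norm_transport_mul_sub_le V hV ha hplaq q x μ).trans ?_))
      · exact (norm_mul_le _ _).trans (by nlinarith [(hV x μ).1, norm_nonneg ((g : Matrix (Fin N) (Fin N) ℂ) - ((hol V q (treeWord (x - q)) : (Matrix (Fin N) (Fin N) ℂ)ˣ) : Matrix (Fin N) (Fin N) ℂ))])
      · exact mul_le_mul_of_nonneg_right (hS x hx) ha
    have IH := norm_conjR_tsum_sub_asum_le V hV ha hplaq X q hR hS (x + e μ) w hw' hP'' (g * V x μ) hg' (δ + R * a) hδ'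
    -- expand one letter
    rw [tsum_cons, asum_cons, asum_cons, stepHol_true, conjR_add, conjR_conjR, List.length_cons, Nat.cast_succ]
    simp only [tstep, stepA, ↓reduceIte, B7Prop1Explicit.Letter.vec_true]
    have hhead : ‖conjR g (X x μ) - conjR (hol V q (treeWord (x - q))) (X x μ)‖ ≤ 2 * δ * ‖X x μ‖ :=
      (norm_conjR_sub_conjR_le (hol_mem hV _ _) hg (X x μ)).trans (by nlinarith [norm_nonneg (X x μ)])
    have hmass0 : 0 ≤ asum (fun y μ => ‖X y μ‖) (x + e μ) w := asum_nonneg _ (fun _ _ => norm_nonneg _) _ w hw'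
    have hX0 : 0 ≤ ‖X x μ‖ := norm_nonneg _
    have hRa : 0 ≤ R * a := mul_nonneg hR ha
    calc ‖conjR g (X x μ) + conjR (g * V x μ) (tsum V X (x + e μ) w)
            - (conjR (hol V q (treeWord (x - q))) (X x μ) + asum (fun y μ => conjR (hol V q (treeWord (y - q))) (X y μ)) (x + e μ) w)‖
          = ‖(conjR g (X x μ) - conjR (hol V q (treeWord (x - q))) (X x μ))
              + (conjR (g * V x μ) (tsum V X (x + e μ) w) - asum (fun y μ => conjR (hol V q (treeWord (y - q))) (X y μ)) (x + e μ) w)‖ := by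
            congr 1; abel
      _ ≤ 2 * δ * ‖X x μ‖ + 2 * (δ + R * a + w.length * (R * a)) * asum (fun y μ => ‖X y μ‖) (x + e μ) w :=
            (norm_add_le _ _).trans (add_le_add hhead IH)
      _ ≤ 2 * (δ + (w.length + 1) * (R * a)) * (‖X x μ‖ + asum (fun y μ => ‖X y μ‖) (x + e μ) w) := by
            nlinarith [mul_nonneg hRa hX0, mul_nonneg (mul_nonneg (Nat.cast_nonneg w.length) hRa) hX0, mul_nonneg hRa hmass0, mul_nonneg hδ0 hmass0]

/-! ## §2 The block `B(q) = q + [0, n]ᵈ`: tree words stay inside, single bonds are at most the block mass -/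

/-- Sites of the block are `q + s`, `s ∈ [0, n]ᵈ`. [cite: Balaban1985Averaging, (2) p.17] -/
theorem exists_boxVec_of_mem_box {n : ℕ} {q y : LSite d} (hy : ∀ i, q i ≤ y i ∧ y i ≤ q i + n) : ∃ s : Fin d → Fin (n + 1), y = q + boxVec (n + 1) s := by
  refine ⟨fun i => ⟨(y i - q i).toNat, by have := hy i; omega⟩, funext fun i => ?_⟩
  have h := hy i
  simp only [Pi.add_apply, boxVec, Int.toNat_of_nonneg (sub_nonneg.2 h.1)]
  ring

/-- On the block, `|y − q|₁ ≤ d·n`. [cite: Balaban1985Averaging, pp.24-25] -/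
theorem l1_sub_le_of_mem_box {n : ℕ} {q y : LSite d} (hy : ∀ i, q i ≤ y i ∧ y i ≤ q i + n) : (l1 (y - q) : ℝ) ≤ d * n := by
  obtain ⟨s, rfl⟩ := exists_boxVec_of_mem_box hy
  rw [add_sub_cancel_left]
  exact l1_intVec_le s

/-- The letters of the tree word `Γ_{q, q+s}`, `s ∈ [0,n]ᵈ`, are positively oriented. [cite: Balaban1985Averaging, p.24] -/
theorem treeWord_boxVec_pos {n : ℕ} (s : Fin d → Fin (n + 1)) : ∀ l ∈ treeWord (boxVec (n + 1) s), l.2 = true := by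
  intro l hl
  rw [treeWord_eq_tw, tw, List.mem_flatMap] at hl
  obtain ⟨κ, -, hκ⟩ := hl
  have hseg : B7Prop1Explicit.seg κ (boxVec (n + 1) s κ) = List.replicate (s κ : ℕ) (κ, true) := by
    simp only [boxVec]; exact seg_natCast κ _
  rw [hseg] at hκ
  rw [List.eq_of_mem_replicate hκ]

/-- The tree word `Γ_{q, q+s}` has `|s|₁ ≤ d·n` letters. [cite: Balaban1985Averaging, p.24] -/
theorem length_treeWord_boxVec_le {n : ℕ} (s : Fin d → Fin (n + 1)) : ((treeWord (boxVec (n + 1) s)).length : ℝ) ≤ d * n := by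
  rw [length_treeWord]; exact l1_intVec_le s

/-- **THE TREE STAYS IN THE BLOCK**: every vertex of `Γ_{q, q+s}` (`s ∈ [0,n]ᵈ`) lies in `q + [0,n]ᵈ` (lit ✓`pathIn_tw`). [cite: Balaban1985Averaging, p.24; Balaban1989LargeFieldI, p.196] -/
theorem pathIn_treeWord_boxVec {n : ℕ} (q : LSite d) (s : Fin d → Fin (n + 1)) :
    PathIn {y : LSite d | ∀ i, q i ≤ y i ∧ y i ≤ q i + n} q (treeWord (boxVec (n + 1) s)) := by
  rw [treeWord_eq_tw]
  refine pathIn_tw _ (List.nodup_reverse.mpr (List.nodup_finRange d)) _ (fun κ _ => by simp [boxVec]) q fun z hz1 hz2 i => ⟨hz1 i, ?_⟩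
  have hmem : i ∈ (List.finRange d).reverse := by simp
  have h2 : z i ≤ q i + ((s i : ℕ) : ℤ) := by
    have := hz2 i
    simpa only [Pi.add_apply, restrict_apply_of_mem hmem, boxVec] using this
  have hs : (s i : ℕ) ≤ n := Nat.lt_succ_iff.mp (s i).isLt
  omega

/-- **A SINGLE BOND IS AT MOST THE BLOCK MASS** (★routeR-w1 F-5b's device, one block): for `y` in the block, `‖G(y, μ)‖ ≤ √(Σ_{s,ν}‖G(q+s, ν)‖²)`. [folklore] -/
theorem norm_le_sqrt_blockSum {𝔸 : Type*} [NormedRing 𝔸] {n : ℕ} (G : LSite d → Fin d → 𝔸) {q y : LSite d} (hy : ∀ i, q i ≤ y i ∧ y i ≤ q i + n) (μ : Fin d) :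
    ‖G y μ‖ ≤ Real.sqrt (∑ s : Fin d → Fin (n + 1), ∑ ν : Fin d, ‖G (q + boxVec (n + 1) s) ν‖ ^ 2) := by
  obtain ⟨s, rfl⟩ := exists_boxVec_of_mem_box hy
  refine Real.le_sqrt_of_sq_le ?_
  have h1 : ‖G (q + boxVec (n + 1) s) μ‖ ^ 2 ≤ ∑ ν : Fin d, ‖G (q + boxVec (n + 1) s) ν‖ ^ 2 :=
    Finset.single_le_sum (f := fun ν => ‖G (q + boxVec (n + 1) s) ν‖ ^ 2) (fun _ _ => sq_nonneg _) (Finset.mem_univ μ)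
  exact h1.trans (Finset.single_le_sum (f := fun s' => ∑ ν : Fin d, ‖G (q + boxVec (n + 1) s') ν‖ ^ 2)
    (fun _ _ => Finset.sum_nonneg fun _ _ => sq_nonneg _) (Finset.mem_univ s))

/-! ## §3 Flat differences of the comb-transported field are covariant differences up to the axial defect; the cube Poincaré inequality with the mean -/

/-- ★ **THE COMB-GAUGE DIFFERENCE ESTIMATE ON `ℤᵈ`** (the `ℤᵈ` twin of ✓`Prop7CovariantCoercivity.norm_conjR_comb_sub_le` — adapted from it): with `T(y) = V(Γ_{q,y})`,
`‖R(T(x + e_ν))X₁ − R(T(x))X₀‖ ≤ ‖R(V(x,ν))X₁ − X₀‖ + 2|x − q|₁a·‖X₀‖`. [cite: Balaban1985Averaging, pp.24–25] -/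
theorem norm_conjR_tree_sub_le (V : LSite d → Fin d → (Matrix (Fin N) (Fin N) ℂ)ˣ) (hV : ∀ x κ, V x κ ∈ U1 (Matrix (Fin N) (Fin N) ℂ)) {a : ℝ} (ha : 0 ≤ a)
    (hplaq : ∀ (x : LSite d) (κ μ : Fin d), κ ≠ μ → ‖((hol V x (plaqWord κ μ) : (Matrix (Fin N) (Fin N) ℂ)ˣ) : Matrix (Fin N) (Fin N) ℂ) - 1‖ ≤ a) (q x : LSite d) (ν : Fin d) (X₀ X₁ : Matrix (Fin N) (Fin N) ℂ) :
    ‖conjR (hol V q (treeWord (x + e ν - q))) X₁ - conjR (hol V q (treeWord (x - q))) X₀‖ ≤ ‖conjR (V x ν) X₁ - X₀‖ + 2 * (l1 (x - q) * a) * ‖X₀‖ := by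
  set T₀ : (Matrix (Fin N) (Fin N) ℂ)ˣ := hol V q (treeWord (x - q)) with hT₀
  set T₁ : (Matrix (Fin N) (Fin N) ℂ)ˣ := hol V q (treeWord (x + e ν - q)) with hT₁
  set g : (Matrix (Fin N) (Fin N) ℂ)ˣ := V x ν with hg
  have hT₀m : T₀ ∈ U1 (Matrix (Fin N) (Fin N) ℂ) := hol_mem hV _ _
  have hT₁m : T₁ ∈ U1 (Matrix (Fin N) (Fin N) ℂ) := hol_mem hV _ _
  have hgm : g ∈ U1 (Matrix (Fin N) (Fin N) ℂ) := hV _ _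
  -- `R(T₁)X₁ − R(T₀)X₀ = R(T₁)(X₁ − R(T₁⁻¹T₀)X₀)` and `R(g)(X₁ − R(g⁻¹)X₀) = R(g)X₁ − X₀`
  have hfac : conjR T₁ X₁ - conjR T₀ X₀ = conjR T₁ (X₁ - conjR (T₁⁻¹ * T₀) X₀) := by
    rw [conjR_sub, conjR_conjR, mul_inv_cancel_left]
  have hfac' : conjR g X₁ - X₀ = conjR g (X₁ - conjR g⁻¹ X₀) := by
    rw [conjR_sub, conjR_conjR, mul_inv_cancel, one_conjR]
  rw [hfac, norm_conjR hT₁m]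
  have hsplit : X₁ - conjR (T₁⁻¹ * T₀) X₀ = (X₁ - conjR g⁻¹ X₀) + (conjR g⁻¹ X₀ - conjR (T₁⁻¹ * T₀) X₀) := by abel
  rw [hsplit]
  refine (norm_add_le _ _).trans (add_le_add (le_of_eq ?_) ?_)
  · rw [hfac', norm_conjR hgm]
  -- `‖R(g⁻¹)X₀ − R(T₁⁻¹T₀)X₀‖ ≤ 2‖g⁻¹ − T₁⁻¹T₀‖·‖X₀‖ ≤ 2|x−q|₁a·‖X₀‖`
  have hw : ‖((g⁻¹ : (Matrix (Fin N) (Fin N) ℂ)ˣ) : Matrix (Fin N) (Fin N) ℂ) - ((T₁⁻¹ * T₀ : (Matrix (Fin N) (Fin N) ℂ)ˣ) : Matrix (Fin N) (Fin N) ℂ)‖ ≤ l1 (x - q) * a := by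
    have hid : ((g⁻¹ : (Matrix (Fin N) (Fin N) ℂ)ˣ) : Matrix (Fin N) (Fin N) ℂ) - ((T₁⁻¹ * T₀ : (Matrix (Fin N) (Fin N) ℂ)ˣ) : Matrix (Fin N) (Fin N) ℂ) = ((T₁⁻¹ : (Matrix (Fin N) (Fin N) ℂ)ˣ) : Matrix (Fin N) (Fin N) ℂ) * ((T₁ : Matrix (Fin N) (Fin N) ℂ) - (T₀ : Matrix (Fin N) (Fin N) ℂ) * (g : Matrix (Fin N) (Fin N) ℂ)) * ((g⁻¹ : (Matrix (Fin N) (Fin N) ℂ)ˣ) : Matrix (Fin N) (Fin N) ℂ) := by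
      rw [Units.val_mul, mul_sub, sub_mul, ← mul_assoc, Units.inv_mul, one_mul, mul_assoc, mul_assoc, Units.mul_inv, mul_one]
    rw [hid]
    calc _ ≤ ‖((T₁⁻¹ : (Matrix (Fin N) (Fin N) ℂ)ˣ) : Matrix (Fin N) (Fin N) ℂ)‖ * ‖(T₁ : Matrix (Fin N) (Fin N) ℂ) - (T₀ : Matrix (Fin N) (Fin N) ℂ) * (g : Matrix (Fin N) (Fin N) ℂ)‖ * ‖((g⁻¹ : (Matrix (Fin N) (Fin N) ℂ)ˣ) : Matrix (Fin N) (Fin N) ℂ)‖ :=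
          (norm_mul_le _ _).trans (mul_le_mul_of_nonneg_right (norm_mul_le _ _) (norm_nonneg _))
      _ ≤ 1 * ‖(T₁ : Matrix (Fin N) (Fin N) ℂ) - (T₀ : Matrix (Fin N) (Fin N) ℂ) * (g : Matrix (Fin N) (Fin N) ℂ)‖ * 1 := by
          gcongr
          · exact hT₁m.2
          · exact hgm.2
      _ = ‖(T₀ : Matrix (Fin N) (Fin N) ℂ) * (g : Matrix (Fin N) (Fin N) ℂ) - (T₁ : Matrix (Fin N) (Fin N) ℂ)‖ := by rw [one_mul, mul_one, norm_sub_rev]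
      _ ≤ l1 (x - q) * a := norm_transport_mul_sub_le V hV ha hplaq q x ν
  have h2 := norm_conjR_sub_conjR_le (Subgroup.mul_mem _ (Subgroup.inv_mem _ hT₁m) hT₀m) (Subgroup.inv_mem _ hgm) X₀
  calc _ ≤ 2 * ‖((g⁻¹ : (Matrix (Fin N) (Fin N) ℂ)ˣ) : Matrix (Fin N) (Fin N) ℂ) - ((T₁⁻¹ * T₀ : (Matrix (Fin N) (Fin N) ℂ)ˣ) : Matrix (Fin N) (Fin N) ℂ)‖ * ‖X₀‖ := h2
    _ ≤ 2 * (l1 (x - q) * a) * ‖X₀‖ := by gcongr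

omit [NeZero N] in
/-- **THE CUBE POINCARÉ INEQUALITY WITH THE MEAN** for `M_N(ℂ)`-valued `F` on `{0,…,n}ᵈ`: `Σ_r‖F r − F̄‖² ≤ (N∕8)(n+1)²·Σ_νΣ_{r_ν<n}‖F(r + e_ν) − F(r)‖²`, `F̄ = (n+1)⁻ᵈΣ_rF r`
(✓`block227_matrix` applied to `F − F̄`, whose sum vanishes). [cite: Balaban1983RegularityDecay, (2.27) p.580] -/
theorem sum_normSq_sub_mean_le (n : ℕ) (F : (Fin d → Fin (n + 1)) → Matrix (Fin N) (Fin N) ℂ) :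
    ∑ r, ‖F r - (((n : ℝ) + 1) ^ d)⁻¹ • ∑ r', F r'‖ ^ 2
      ≤ N / 8 * ((n : ℝ) + 1) ^ 2 * ∑ ν : Fin d, ∑ r ∈ univ.filter (fun r : Fin d → Fin (n + 1) => r ν ≠ Fin.last n), ‖F (stepUp r ν) - F r‖ ^ 2 := by
  set m : Matrix (Fin N) (Fin N) ℂ := (((n : ℝ) + 1) ^ d)⁻¹ • ∑ r', F r' with hm
  have hcard : (Fintype.card (Fin d → Fin (n + 1)) : ℝ) = ((n : ℝ) + 1) ^ d := by
    rw [Fintype.card_fun, Fintype.card_fin, Fintype.card_fin]; push_cast; ring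
  have hpos : (0 : ℝ) < ((n : ℝ) + 1) ^ d := by positivity
  have hsum0 : ∑ r, (F r - m) = 0 := by
    rw [Finset.sum_sub_distrib, Finset.sum_const, Finset.card_univ, ← Nat.cast_smul_eq_nsmul ℝ, hcard, hm, smul_smul, mul_inv_cancel₀ hpos.ne',
      one_smul, sub_self]
  have h := block227_matrix n d (fun r => F r - m)
  simp only [sub_sub_sub_cancel_right, hsum0, norm_zero, zero_pow two_ne_zero, mul_zero, add_zero] at h
  have h8 : ∑ r, ‖F r - m‖ ^ 2 ≤ N / 8 * ((n : ℝ) + 1) ^ 2 * ∑ ν : Fin d, ∑ r ∈ univ.filter (fun r : Fin d → Fin (n + 1) => r ν ≠ Fin.last n), ‖F (stepUp r ν) - F r‖ ^ 2 := by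
    rw [div_mul_eq_mul_div, div_mul_eq_mul_div, le_div_iff₀ (by norm_num : (0 : ℝ) < 8), mul_comm]
    exact h
  exact h8

end Summit.QuantumFields.YangMills.Theorems.Prop7CornerCombInCellLetters
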